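/-
COR-CM (cell pub-hodgecm2) — TRANSPOSITION surge, dictionary item (iv) of rfwf v3 §4.2: the two open inputs of the typed interface
`Transposition/Item4SignsPlane.lean` (p272401 ✔) DISCHARGED.  Authored and filed by the typer seat prover-pub-hodgecm2-tr-typer-4-0 under
its own RULE (1) pattern `Transposition/Item4*.lean` (HOME/INBOX l.3654), as `Transposition/Item4SignsPlaneHolds.lean`, after the interface
landed and the combined file lane-checked rc 0; `pub-hodgecm2-tr-prover-4` (pattern `Item4Holds*.lean`) is told BY NAME in HOME/INBOX and in
`HOME/transposition/ITEM-4-TYPED.ok`.  Port of the stage-1 package `HodgeCM/Proofs/RealisationConstruction.lean:55–198`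
(`reqPos_pairSum`, `exists_signsForced`, `exists_seesawDatum`; pkg root `run/shared/lean/pub/pub-hodgecm/lean/HodgeCMPerL/`) against TREE
names — the PARAMETRIC tag of item (iv) executed.  FRAMING: HC_CM is NOT proved; this closes the V-free item (iv) inputs only.
-/
import Summits.HodgeConjecture.CorCM.B01.Transposition.Item4SignsPlane
import Literature.NumberTheory.NumberFields.CMFieldPrescribedSigns
import HarnessLib

/-!
# Transposition item (iv) HOLDS: `SeesawDatumExists` and `FaceSignDatumExists` are theorems

Def 3.2's four lines WITH THE FORCED SIGNS exist for every CM field, every quadruple of CM types with the pair-sum identity and every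
sign recipe (`seesawDatumExists_holds`): weak approximation at the real places (`NumberFields.exists_isReal_signs`) for `a₀, a₁, a₂`,
`a₃ := a₀a₁a₂⁻¹` (required sign by the parity half of PerL Lemma 3.3(b), `SignRecipe.reqPos_pairSum`; equal discriminants on the nose),
and Landherr's classification of hermitian planes (`QuadraticForms.hermitianPlanes_isometric_of_invariants`) for `W₁ ⊕ W₂ ≅ W₃ ⊕ W₄`.
The face form `faceSignDatumExists_holds` follows by `faceSignDatumExists_of_seesawDatumExists` (`pairSum_psi`).
-/

noncomputable section

open NumberField NumberField.InfinitePlace NumberField.ComplexEmbedding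

namespace Summit.HodgeConjecture.CorCM

namespace Transposition

open Literature.AlgebraicGeometry.Motives (CMType)

/-- Sign of `x y / z` for non-zero reals (port of the stage-1 helper). [folklore] -/
theorem pos_mul_div_iff {x y z : ℝ} (hx : x ≠ 0) (hy : y ≠ 0) (hz : z ≠ 0) :
    (0 < x * y / z) ↔ ((0 < x) ↔ ((0 < y) ↔ (0 < z))) := by
  rw [div_pos_iff, mul_pos_iff, mul_neg_iff]
  rcases hx.lt_or_gt with hx | hx <;> rcases hy.lt_or_gt with hy | hy <;> rcases hz.lt_or_gt with hz | hz <;>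
    simp [hx, hx.not_gt, hy, hy.not_gt, hz, hz.not_gt]

/-- `decide p = b` from `p ↔ b = true` (port of the stage-1 helper). [folklore] -/
theorem decide_eq_of_iff' {p : Prop} [Decidable p] {b : Bool} (h : p ↔ b = true) : decide p = b := by
  cases b
  · simpa using h
  · simpa using h

/-- `ι b = r ≠ 0` forces `b ≠ 0`. [folklore] -/
theorem ne_zero_of_embedding {F : CMField} (ι : F →+* ℂ) {b : F} {r : ℝ} (h : ι b = r) (hr : r ≠ 0) : b ≠ 0 := by
  rintro rfl
  rw [map_zero] at h
  exact hr (by exact_mod_cast h.symm)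

namespace SignRecipe

variable {F : CMField} (R : SignRecipe F)

/-- **PerL Lemma 3.3(b) for the required signs** (tex ll.280–298; port of stage-1 `ThetaModel.reqPos_pairSum`,
`RealisationConstruction.lean:96`): the pair-sum identity gives equal sign multisets `{s(W₁), s(W₂)} = {s(W₃), s(W₄)}` at every complex
embedding, and determines `s(W₄)` from the other three (parity form). [folklore] -/
theorem reqPos_pairSum (Ψ : Fin 4 → CMType F) (hΨ : PairSum Ψ) (τ : F →+* ℂ) :
    (({R.reqPos (Ψ 0) τ, R.reqPos (Ψ 1) τ} : Multiset Bool) = {R.reqPos (Ψ 2) τ, R.reqPos (Ψ 3) τ}) ∧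
      (((R.reqPos (Ψ 0) τ = true) ↔ ((R.reqPos (Ψ 1) τ = true) ↔ (R.reqPos (Ψ 2) τ = true))) ↔
        (R.reqPos (Ψ 3) τ = true)) := by
  unfold SignRecipe.reqPos
  have h := hΨ (R.kappa τ)
  rcases ind_eq (Ψ 0) (R.kappa τ) with h0 | h0 <;>
    rcases ind_eq (Ψ 1) (R.kappa τ) with h1 | h1 <;>
    rcases ind_eq (Ψ 2) (R.kappa τ) with h2 | h2 <;>
    rcases ind_eq (Ψ 3) (R.kappa τ) with h3 | h3 <;>
    rw [h0, h1, h2, h3] at h ⊢ <;> norm_num at h <;>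
    cases R.frameSign τ <;> simp <;> exact Multiset.cons_swap _ _ _

/-- **Def 3.2 with the forced signs, CONSTRUCTED** (PerL tex ll.299–314; port of stage-1 `ThetaModel.exists_signsForced`,
`RealisationConstruction.lean:122`): four conjugation-fixed non-zero `a_i ∈ F` with the required signs and `a₀a₁ = a₂a₃`. [folklore] -/
theorem exists_signsForced (Ψ : Fin 4 → CMType F) (hΨ : PairSum Ψ) :
    ∃ a : Fin 4 → F, (∀ i, IsCMField.complexConj F (a i) = a i) ∧ (∀ i, a i ≠ 0) ∧ a 0 * a 1 = a 2 * a 3 ∧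
      ∀ (i : Fin 4) (τ : F →+* ℂ), (0 < (τ (a i)).re ↔ R.reqPos (Ψ i) τ = true) := by
  -- the required sign is a function of the place
  let P : Fin 4 → InfinitePlace F → Bool := fun i w => R.reqPos (Ψ i) w.embedding
  have hP : ∀ (i : Fin 4) (τ : F →+* ℂ), R.reqPos (Ψ i) τ = P i (InfinitePlace.mk τ) := by
    intro i τ
    have hτ : InfinitePlace.mk τ = InfinitePlace.mk (InfinitePlace.mk τ).embedding := by rw [mk_embedding]
    rcases mk_eq_iff.mp hτ with h | h
    · simp only [P]; rw [← h]
    · simp only [P]; rw [← h, R.reqPos_conjugate]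
  -- a₀, a₁, a₂ by weak approximation at the infinite places
  obtain ⟨τ₀⟩ := (inferInstance : Nonempty (F →+* ℂ))
  have hb : ∀ i : Fin 4, ∃ b : F, IsCMField.complexConj F b = b ∧ b ≠ 0 ∧
      ∀ τ : F →+* ℂ, ∃ r : ℝ, τ b = r ∧ r ≠ 0 ∧ (0 < r ↔ R.reqPos (Ψ i) τ = true) := by
    intro i
    obtain ⟨b, hb, h⟩ := Literature.NumberTheory.NumberFields.exists_isReal_signs F (P i)
    obtain ⟨r₁, hr₁, hr₁0, -⟩ := h τ₀
    refine ⟨b, hb, ne_zero_of_embedding τ₀ hr₁ hr₁0, fun τ => ?_⟩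
    obtain ⟨r, hr, hr0, hiff⟩ := h τ
    exact ⟨r, hr, hr0, by rw [hP]; exact hiff⟩
  obtain ⟨b0, hb0, hb0ne, h0⟩ := hb 0
  obtain ⟨b1, hb1, hb1ne, h1⟩ := hb 1
  obtain ⟨b2, hb2, hb2ne, h2⟩ := hb 2
  refine ⟨![b0, b1, b2, b0 * b1 * b2⁻¹], ?_, ?_, ?_, ?_⟩
  · intro i
    fin_cases i
    · exact hb0
    · exact hb1
    · exact hb2
    · show IsCMField.complexConj F (b0 * b1 * b2⁻¹) = b0 * b1 * b2⁻¹
      rw [map_mul, map_mul, map_inv₀, hb0, hb1, hb2]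
  · intro i
    fin_cases i
    · exact hb0ne
    · exact hb1ne
    · exact hb2ne
    · show b0 * b1 * b2⁻¹ ≠ 0
      exact mul_ne_zero (mul_ne_zero hb0ne hb1ne) (inv_ne_zero hb2ne)
  · show b0 * b1 = b2 * (b0 * b1 * b2⁻¹)
    field_simp
  · intro i τ
    obtain ⟨r0, e0, hr0, i0⟩ := h0 τ
    obtain ⟨r1, e1, hr1, i1⟩ := h1 τ
    obtain ⟨r2, e2, hr2, i2⟩ := h2 τ
    fin_cases i
    · show 0 < (τ b0).re ↔ R.reqPos (Ψ 0) τ = true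
      rw [e0, Complex.ofReal_re]; exact i0
    · show 0 < (τ b1).re ↔ R.reqPos (Ψ 1) τ = true
      rw [e1, Complex.ofReal_re]; exact i1
    · show 0 < (τ b2).re ↔ R.reqPos (Ψ 2) τ = true
      rw [e2, Complex.ofReal_re]; exact i2
    · show 0 < (τ (b0 * b1 * b2⁻¹)).re ↔ R.reqPos (Ψ 3) τ = true
      have e3 : τ (b0 * b1 * b2⁻¹) = ((r0 * r1 / r2 : ℝ) : ℂ) := by
        rw [map_mul, map_mul, map_inv₀, e0, e1, e2]; push_cast; rw [div_eq_mul_inv]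
      rw [e3, Complex.ofReal_re, pos_mul_div_iff hr0 hr1 hr2, i0, i1, i2]
      exact (R.reqPos_pairSum Ψ hΨ τ).2

/-- **Def 3.2 + Lemma 3.3 ⇒ the sign/plane datum** (PerL tex ll.269–338; port of stage-1 `ThetaModel.exists_seesawDatum`,
`RealisationConstruction.lean:183`): with the forced signs the planes `W₁ ⊕ W₂`, `W₃ ⊕ W₄` have the same signature at every place
(`reqPos_pairSum`) and the same discriminant, hence are isometric by Landherr (tree `hermitianPlanes_isometric_of_invariants`). [folklore] -/
theorem nonempty_faceSignDatum (Ψ : Fin 4 → CMType F) (hΨ : PairSum Ψ) : Nonempty (FaceSignDatum R Ψ) := by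
  obtain ⟨a, ha, hne, hdisc, hsign⟩ := R.exists_signsForced Ψ hΨ
  have hmult : ∀ τ : F →+* ℂ,
      ({decide (0 < (τ (a 0)).re), decide (0 < (τ (a 1)).re)} : Multiset Bool) =
        {decide (0 < (τ (a 2)).re), decide (0 < (τ (a 3)).re)} := by
    intro τ
    rw [decide_eq_of_iff' (hsign 0 τ), decide_eq_of_iff' (hsign 1 τ), decide_eq_of_iff' (hsign 2 τ),
      decide_eq_of_iff' (hsign 3 τ)]
    exact (R.reqPos_pairSum Ψ hΨ τ).1
  obtain ⟨g, hg⟩ := Literature.NumberTheory.QuadraticForms.hermitianPlanes_isometric_of_invariants F a ha hne hmult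
    ⟨1, one_ne_zero, by rw [map_one, mul_one, mul_one, hdisc]⟩
  exact ⟨{ a := a, a_real := ha, a_ne := hne, iso := ⟨g, hg⟩, forced := hsign }⟩

end SignRecipe

/-- **Item (iv), general form, HOLDS.** [folklore] -/
theorem seesawDatumExists_holds : SeesawDatumExists :=
  fun _ Ψ hΨ R => R.nonempty_faceSignDatum Ψ hΨ

/-- **Item (iv) of rfwf v3 §4.2 — the typed axiom `FaceSignDatumExists` HOLDS** (for every Galois CM field of degree `≥ 6`, every face,
every admissible `ι₁`, every sign recipe). [folklore] -/
theorem faceSignDatumExists_holds : FaceSignDatumExists :=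
  faceSignDatumExists_of_seesawDatumExists seesawDatumExists_holds

end Transposition

end Summit.HodgeConjecture.CorCM

end
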